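import Literature.NumberTheory.EllipticCurves.GreenbergSelmerDualDataExistsProofs
import Literature.NumberTheory.EllipticCurves.H1CorestrictionIndexTwo
import Literature.NumberTheory.EllipticCurves.SelmerCorankProofs
import HarnessLib

/-!
# Route `SignedLowerHalves`, crux L `SmallImageLowerHalfBothSigns` (stmt-BirchSwinnertonDyer-23599), line `rtt_w3` v10 — brick D5-θ (cocycle form) of COUNT_π
# (memo `Lines/rtt_w3-BRIEF-E1b-g6.md` §9.3): a class of `H¹(H, M)` KILLED BY THE SCALAR `r` is represented by a cocycle WITH VALUES IN `M[r]`,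
# as soon as `r` acts surjectively on `M` — no hypothesis on `H⁰`. This is the half of «`Sel[π] ≅ Sel^{res}(M[π])`» that the UPPER bound
# COUNT_π consumes (`M = (F/𝒪)(θ)` is `π`-divisible).

LEAD `cruxlead-stmt-BirchSwinnertonDyer-23599` g6 (cell `bsd-ssimc`; `--supports stmt-BirchSwinnertonDyer-23599 --as helper`). THEOREMS ONLY (no definition, no
named fact, no instance, no `sorry`); generic continuous group cohomology on the tree's explicit cocycles (`contOneCocycles`, `oneCocycleClass`,
`GreenbergSelmer.scalarH1`, `cobCocycle`). BSD / crux L / COUNT are NOT proved here.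

WHAT (`H ≤ G` topological, `M` a discrete `G`-module with continuous orbit maps, scalars `R` with `Module R M`, `SMulCommClass G R M`):
* `smul_apply_val_of_scalarH1` — bookkeeping: `scalarH1 r [f] = [x ↦ r • f x]`.
* ★ `exists_cocycle_smul_eq_zero_of_scalarH1_eq_zero` — if `r • (·)` is onto on `M` and `scalarH1 r c = 0`, then `c = [φ]` with `r • φ(x) = 0` for all `x`
  (from `r • f = ∂m`, `m = r • m'`: `φ := f − ∂m'`).
* `scalarH1_eq_zero_of_forall_smul_eq_zero` — conversely a cocycle with `r`-torsion values has an `r`-torsion class.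
* ★ `scalarH1_eq_zero_iff_exists_cocycle` — the two together; `subset_image_oneCocycleClass_of_scalarH1` — for a subgroup `Sg ≤ H¹(H, M)`:
  `Sg[r] ⊆ [·] '' {φ | [φ] ∈ Sg ∧ ∀ x, r • φ x = 0}` (so `#Sg[r]` is bounded by any count of such cocycles modulo coboundaries — the residual side).

References: [SerreGaloisCohomology1997] I §2.2 (cocycles, coboundaries), I §5.1; [GreenbergVatsal2000] §2 p. 19 («`Sel(E[p]) → Sel(E[p^∞])[p]`»);
[EmertonPollackWeston2006] §3.1 / Thm. 3.1.1.
-/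

set_option autoImplicit false
set_option linter.dupNamespace false -- D-0017: single-problem summit, the namespace repeats the problem name by design
noncomputable section

open scoped Classical

universe u

namespace Summit.BirchSwinnertonDyer.BirchSwinnertonDyer.Theorems.SmallImageCharSignedSelmer

open Literature.NumberTheory.EllipticCurves Literature.NumberTheory.GaloisRepresentations

variable {G : Type u} [Group G] [TopologicalSpace G] [IsTopologicalGroup G] (H : Subgroup G)
  (M : Type u) [AddCommGroup M] [DistribMulAction G M] [TopologicalSpace M] [DiscreteTopology M]
  {R : Type*} [Ring R] [Module R M] [SMulCommClass G R M]

/-- Bookkeeping: the cocycle representing `scalarH1 r [f]` is `x ↦ r • f x`. [cite: EmertonPollackWeston2006, §3.1] -/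
theorem scalarH1_oneCocycleClass_eq (r : R) (f : contOneCocycles (discreteTopRep H M)) :
    ∃ g : contOneCocycles (discreteTopRep H M),
      GreenbergSelmer.scalarH1 H M r (oneCocycleClass _ f) = oneCocycleClass _ g ∧ ∀ x : H, g.1 x = r • f.1 x :=
  ⟨_, GreenbergSelmer.scalarH1_oneCocycleClass H M r f, fun _ ↦ rfl⟩

variable {H M}

/-- ★ **An `r`-torsion class is represented by an `M[r]`-valued cocycle** when `r` acts surjectively on `M`: if `scalarH1 r [f] = 0` then
`r • f = ∂m` for some `m = r • m'`, and `φ := f − ∂m'` has `[φ] = [f]` and `r • φ(x) = r • f(x) − (x • (r • m') − r • m') = 0`. No hypothesis on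
`H⁰(H, M)` is needed for this direction. [cite: GreenbergVatsal2000, §2 p. 19] [cite: SerreGaloisCohomology1997, I §5.1] -/
theorem exists_cocycle_smul_eq_zero_of_scalarH1_eq_zero (hM : ∀ m : M, Continuous fun g : G ↦ g • m)
    {r : R} (hdiv : ∀ m : M, ∃ m' : M, r • m' = m) {c : subgroupH1 H M} (hc : GreenbergSelmer.scalarH1 H M r c = 0) :
    ∃ φ : contOneCocycles (discreteTopRep H M), oneCocycleClass _ φ = c ∧ ∀ x : H, r • φ.1 x = 0 := by
  obtain ⟨f, rfl⟩ := oneCocycleClass_surjective _ c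
  obtain ⟨g, hg, hgval⟩ := scalarH1_oneCocycleClass_eq H M r f
  rw [hg, oneCocycleClass_eq_zero_iff] at hc
  obtain ⟨m, hm⟩ := hc
  obtain ⟨m', rfl⟩ := hdiv m
  have hcont : Continuous fun x : H ↦ x • m' := (hM m').comp continuous_subtype_val
  refine ⟨f - cobCocycle m' hcont, by rw [oneCocycleClass_sub, oneCocycleClass_cobCocycle, sub_zero], fun x ↦ ?_⟩
  have hx : r • f.1 x = x • (r • m') - r • m' := by rw [← hgval x]; exact hm x
  rw [sub_apply_val, cobCocycle_apply, smul_sub, smul_sub, hx, Subgroup.smul_def, Subgroup.smul_def, ← smul_comm (x : G) r m', sub_self]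

/-- **Conversely, an `M[r]`-valued cocycle has an `r`-torsion class.** [cite: EmertonPollackWeston2006, §3.1] -/
theorem scalarH1_eq_zero_of_forall_smul_eq_zero {r : R} (φ : contOneCocycles (discreteTopRep H M)) (hφ : ∀ x : H, r • φ.1 x = 0) :
    GreenbergSelmer.scalarH1 H M r (oneCocycleClass _ φ) = 0 := by
  obtain ⟨g, hg, hgval⟩ := scalarH1_oneCocycleClass_eq H M r φ
  rw [hg]
  have h0 : g = 0 := by
    apply Subtype.ext
    ext x
    rw [hgval, hφ]
    rfl
  rw [h0, oneCocycleClass_zero]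

/-- ★ **`scalarH1 r c = 0 ↔ c` is represented by an `M[r]`-valued cocycle** (`r` acting surjectively on `M`). [cite: GreenbergVatsal2000, §2 p. 19] -/
theorem scalarH1_eq_zero_iff_exists_cocycle (hM : ∀ m : M, Continuous fun g : G ↦ g • m)
    {r : R} (hdiv : ∀ m : M, ∃ m' : M, r • m' = m) (c : subgroupH1 H M) :
    GreenbergSelmer.scalarH1 H M r c = 0 ↔
      ∃ φ : contOneCocycles (discreteTopRep H M), oneCocycleClass _ φ = c ∧ ∀ x : H, r • φ.1 x = 0 :=
  ⟨exists_cocycle_smul_eq_zero_of_scalarH1_eq_zero hM hdiv, by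
    rintro ⟨φ, rfl, hφ⟩; exact scalarH1_eq_zero_of_forall_smul_eq_zero φ hφ⟩

/-- **The `r`-torsion of a subgroup `Sg ≤ H¹(H, M)` is covered by the `M[r]`-valued cocycles whose class lies in `Sg`** — the shape COUNT_π consumes
(`Sg = Sel^{ε,S₀K}_𝒪(K_∞, (F/𝒪)(θ))`, `r = π`, `M[π] = k_F(θ̄)`): `#Sg[r]` is at most the number of such cocycles modulo any relation finer than
cohomology. [cite: GreenbergVatsal2000, §2 p. 19] [cite: EmertonPollackWeston2006, Thm. 3.1.1] -/
theorem torsion_subset_image_oneCocycleClass (hM : ∀ m : M, Continuous fun g : G ↦ g • m)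
    {r : R} (hdiv : ∀ m : M, ∃ m' : M, r • m' = m) (Sg : AddSubgroup (subgroupH1 H M)) :
    {c : subgroupH1 H M | c ∈ Sg ∧ GreenbergSelmer.scalarH1 H M r c = 0} ⊆
      oneCocycleClass (discreteTopRep H M) ''
        {φ : contOneCocycles (discreteTopRep H M) | oneCocycleClass _ φ ∈ Sg ∧ ∀ x : H, r • φ.1 x = 0} := by
  rintro c ⟨hcS, hc⟩
  obtain ⟨φ, hφc, hφ⟩ := exists_cocycle_smul_eq_zero_of_scalarH1_eq_zero hM hdiv hc
  exact ⟨φ, ⟨hφc ▸ hcS, hφ⟩, hφc⟩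

end Summit.BirchSwinnertonDyer.BirchSwinnertonDyer.Theorems.SmallImageCharSignedSelmer

end
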